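import Literature.MathematicalPhysics.QuantumFieldTheory.Balaban1983to89.B5Eq147Landau
import Literature.MathematicalPhysics.QuantumFieldTheory.Balaban1983to89.B5Eq123Torus

/-!
# `Balaban1983to89.B5Eq147FromEq123` — T. Bałaban, *Propagators and renormalization transformations for lattice gauge
# theories. I*, Commun. Math. Phys. **95** (1984) 17–40 [Balaban1984PropagatorsI], pp. 25–26: **(1.23) ⟹ (1.47)** — the
# gauge-fixing density `𝒢_α` of the transformed integral (1.23) replaced by the Landau δ-function `δ_R(∂*A)` ((1.40)/(1.41),
# (1.46)), PROVED on the typed tower of `B5SectBStatements` in the exact form: `rt47 k B = c·rt23 k α B` with ONE constant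
# `c` for all `α` and `B`

statement-level skeleton of published theorems with citation tags; proofs where landed; nothing here is a claim about the Yang–Mills mass gap

PDF held: `paper:balaban1984-cmp95-propagators-rt-i` (journal page = PDF page + 16); pages read AS IMAGES by this seat:
renders `…/1984-cmp95-propagators-rt-I/…-p005-x2.png` (p. 21: (1.22)–(1.24)), `…-p009-x2.png` (p. 25: (1.40)–(1.41)),
`…-p010-x2.png` (p. 26: (1.46)–(1.47)).

CITATION HEADER (lean-in-tree rule).  Cell `lit-balaban` (HOME `run/shared/lean/pub/lit-balaban/`), unit `lit-balaban-p16`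
gen 2 (Phase-2 proof seat p16; `literature-prover-lit-balaban-p16-g2-0`); WHAT IS REPRODUCED = the printed passage from
SKELETON row **B5.Eq1.23** (typed `B5SectBStatements.rt23/fp22/Claim122/Eq123`, owner r02; mechanism p22
`B5ChangeOfGauge123`, concrete instance p37 `B5Eq123Torus` — both imported and USED, nothing re-derived) to row
**B5.Eq1.47** (typed+proved for the (1.17) integral in this seat's `B5Eq147Landau`): «The equality (1.23) gives us a
composition of k renormalization transformations with the new gauge fixing density 𝒢_α. In the sequel it will be convenient
to take the limit α → 0, i.e. to consider Landau gauge.»; plus the DICTIONARY between the two typings of «∂*»/«Δ» on the tower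
that landed the same hour (`B5Eq147Landau.Dv/Lap` = adjoint-based, p37's `B5Eq123Torus.dvR/LapR` = formula/matrix-based):
`Dv_eq_dvR`, `Lap_eq_LapR`.  Kind «proof of a printed implication between typed objects»: no definition of a printed object
and no `Prop` fact is introduced (plumbing: the Landau-slice coordinates `LanDir`/`coordRaw`/`coordMap`/`coordEquiv` only).

WHAT IS PRINTED (verbatim).  p. 25 [PDF 9]: «and from its definition it follows that ∫dλ δ(Q′_kλ)𝒢_α(∂*A^λ) = 1.»; «so the
density 𝒢_α has a limit as α → 0, 𝒢_α(∂*A) ⟶_{α→0} ∣det(Δ↾_{N(Q′_k)})∣δ_R(∂*A), (1.41)»; p. 26 [PDF 10]: «We may introduce this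
gauge from the beginning using the equation ∫dλ δ(Q′_kλ)∣det(Δ↾_{N(Q′_k)})∣δ_R(∂*A − Δλ) = 1. (1.46) We have to calculate the
integral ((ST)^k e^{−S})(B) = z′^{(k)}∣det(Δ↾_{N(Q′_k)})∣∫dA δ(B − Q_kA)δ_R(∂*A) exp(−½⟨∂A, ∂A⟩). (1.47)»; p. 21 [PDF 5]: the
unit (1.22) and «= z′^{(k)}∫dA δ(B − Q_kA)exp(−(1/2α)⟨∂*A, ∂*A⟩)·(∫dλ δ(Q′_kλ)exp(−(1/2α)⟨∂*A^λ, ∂*A^λ⟩))⁻¹ e^{−S^η(A)}. (1.23)».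

WHAT THIS FILE PROVES (kernel-checked, 0 sorry, axioms ⊆ {propext, Classical.choice, Quot.sound}).
§1 Landau slice ⊕ residual orbit are coordinates of the fibre directions: `coordEquiv k : (N(Q_k) ∩ Lan) × N(Q′_k) ≃L N(Q_k)`,
   `(m, λ) ↦ m − ∂λ` (from `B5Eq147Landau.isCompl_Lan_orbit`, `orbit_le_ker`, and injectivity of `∂` on `N(Q′_k)`).
§2 DICTIONARY `Dv = dvR`, `Lap = LapR` (so `Lan k` reads `{A : R∂*A = 0}` in p37's letters too: `mem_Lan_iff_dvR`); the
   measurability inputs are p37's `continuous_divSq`/`continuous_actionEta`, the orbit integral is p37's `fp22_eq_orbit`.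
§3 **`rt47_eq_const_mul_rt23`**: ONE constant `c > 0` with `∫dA δ(B − Q_kA)δ_R(∂*A)e^{−S^η} = c·∫dA δ(B − Q_kA)𝒢-weight⁻¹…
   e^{−S^η}` = `c·rt23 k α B` for EVERY `α` at which (1.22)'s denominator is non-zero (`Claim122 k α`; p37's `claim122`
   discharges it for `α > 0`: `rt47_eq_const_mul_rt23_of_pos`) and every `B` — by p22's `B5ChangeOfGauge123.eq123_zprime` with
   the Landau slice: the orbit integral of the weight `g(A^λ)/∫g(A^{λ′})dλ′` is `1` («from its definition it follows that
   ∫dλ δ(Q′_kλ)𝒢_α(∂*A^λ) = 1»), whence **`rt23_eq_rt23`**: `rt23 k α B` does not depend on `α > 0` (the exact content of the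
   limit (1.41) at the level of (1.23)), **`eq147_of_eq123`**: (1.23) ⟹ (1.47), and `eq147_holds'` — (1.47) for every `k`
   (d ≥ 2) ALONG THE PRINTED ROUTE (1.17) → (1.23) → (1.47) (p37's `eq123_holds`; same statement as `B5Eq147Landau.eq147_holds`,
   second proof).

HONEST SCOPE / READINGS.  (i) The weak limit (1.41) of the densities is not formalised (tree: `B5GaussSectC.tendsto_integral_calG_torus`);
what is proved is the stronger exact statement the print announces with (1.46): the (1.23)-integral equals the Landau-gauge
integral up to a constant, for every admissible `α`.  (ii) `Claim122 k α` («we will see that it is different from 0») is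
carried as the typed hypothesis of r02's statement file in the uniform statement and discharged by p37's theorem
`B5Eq123Torus.claim122` (`α > 0`) in the corollaries; not re-proved here.  (iii)
Constants: `c` is the Jacobian of the coordinates of §1 in the flat normalisations (p22's `addHaarScalarFactor`), independent of
`α`, `B`.  (iv) U = 1, every `d`, `L ≥ 1`, torus, `k`.  Value = kernel certificate of the printed step (1.23) → (1.47); NOT summit
progress.
-/

open scoped BigOperators
open MeasureTheory

namespace Literature.MathematicalPhysics.QuantumFieldTheory.Balaban1983to89.B5Eq147FromEq123

open B5SectBStatements B5Eq114Gauss B5HierGaugeTorus B5Eq147Landau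
open B5Eq123Torus (resid fdir mem_resid_iff mem_fdir_iff fp22_eq_orbit dvR LapR)
open B5Prop11Plancherel (Tor fine unitVec)

noncomputable section

variable {d : ℕ} (L : ℕ) (M : Fin d → ℕ) [NeZero L] [hM : ∀ μ, NeZero (M μ)]

/-! ## §1  Landau slice ⊕ residual orbit = coordinates of `N(Q_k)` -/

/-- the Landau slice directions `N(Q_k) ∩ {R∂*A = 0}`. [cite: Balaban1984PropagatorsI, (1.47) p.26] -/
abbrev LanDir (k : ℕ) : Submodule ℝ (Fld (towerM L M k)) := dirSpace (Qk L M k) (Lan L M k)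

/-- `∂` is injective on `N(Q′_k)` (the hierarchical gauge leaves no residual freedom; p37's `hierGauge_unique`).
[cite: Balaban1984PropagatorsI, (1.23) p.21] -/
theorem eq_zero_of_Dg_eq_zero (k : ℕ) {l : Scl (towerM L M k)} (hl : Qsk L M k l = 0) (h0 : Dg L M k l = 0) : l = 0 := by
  refine hierGauge_unique L M k 0 l 0 hl ?_ (map_zero _) ?_
  · rw [gaugeR_eq_sub_Dg, h0, sub_zero]; exact Submodule.zero_mem _
  · rw [gaugeR_eq_sub_Dg, map_zero, sub_zero]; exact Submodule.zero_mem _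

/-- the coordinate map `(m, λ) ↦ m − ∂λ`, raw. [cite: Balaban1984PropagatorsI, (1.23) p.21, (1.46) p.26] -/
def coordRaw (k : ℕ) : (LanDir L M k × resid L M k) →ₗ[ℝ] Fld (towerM L M k) :=
  (LanDir L M k).subtype ∘ₗ LinearMap.fst ℝ _ _ - Dg L M k ∘ₗ (resid L M k).subtype ∘ₗ LinearMap.snd ℝ _ _

/-- pointwise. [cite: Balaban1984PropagatorsI, (1.46) p.26] -/
theorem coordRaw_apply (k : ℕ) (p : LanDir L M k × resid L M k) :
    coordRaw L M k p = (p.1 : Fld (towerM L M k)) - Dg L M k (p.2 : Scl (towerM L M k)) := rfl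

/-- it lands in `N(Q_k)` («δ(B − Q_kA) is invariant with respect to gauge transformations λ satisfying Q′_kλ = 0»).
[cite: Balaban1984PropagatorsI, (1.20) p.20] -/
theorem coordRaw_mem (k : ℕ) (p : LanDir L M k × resid L M k) : coordRaw L M k p ∈ fdir L M k := by
  rw [coordRaw_apply, mem_fdir_iff, map_sub, ((mem_dirSpace_iff _).1 p.1.2).1,
    Qk_Dg_eq_zero L M k ((mem_resid_iff L M k _).1 p.2.2), sub_zero]

/-- the coordinate map into `N(Q_k)`. [cite: Balaban1984PropagatorsI, (1.46) p.26] -/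
def coordMap (k : ℕ) : (LanDir L M k × resid L M k) →ₗ[ℝ] fdir L M k :=
  (coordRaw L M k).codRestrict _ (coordRaw_mem L M k)

/-- pointwise. [cite: Balaban1984PropagatorsI, (1.46) p.26] -/
theorem coordMap_coe (k : ℕ) (p : LanDir L M k × resid L M k) :
    ((coordMap L M k p : fdir L M k) : Fld (towerM L M k)) = (p.1 : Fld (towerM L M k)) - Dg L M k (p.2 : Scl _) := rfl

/-- **slice ⊕ orbit coordinates are coordinates**: `(m, λ) ↦ m − ∂λ` is a bijection `(N(Q_k) ∩ Lan) × N(Q′_k) → N(Q_k)`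
(`Fld = Lan ⊕ ∂N(Q′_k)`, `∂N(Q′_k) ≤ N(Q_k)`, `∂` injective on `N(Q′_k)`). [cite: Balaban1984PropagatorsI, (1.46) p.26] -/
theorem coordMap_bijective (k : ℕ) : Function.Bijective (coordMap L M k) := by
  have hc := isCompl_Lan_orbit L M k
  constructor
  · rw [← LinearMap.ker_eq_bot, LinearMap.ker_eq_bot']
    rintro ⟨m, l⟩ h
    have h' : (m : Fld (towerM L M k)) - Dg L M k (l : Scl _) = 0 := by
      have := congrArg (fun w : fdir L M k => (w : Fld (towerM L M k))) h
      simpa only [coordMap_coe, Submodule.coe_zero] using this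
    have hmO : (m : Fld (towerM L M k)) ∈ orbit L M k := by
      rw [sub_eq_zero] at h'
      rw [h']; exact (mem_orbit_iff L M k _).2 ⟨l, (mem_resid_iff L M k _).1 l.2, rfl⟩
    have hm0 : (m : Fld (towerM L M k)) = 0 := by
      have := hc.inf_eq_bot
      rw [Submodule.eq_bot_iff] at this
      exact this _ (Submodule.mem_inf.2 ⟨((mem_dirSpace_iff _).1 m.2).2, hmO⟩)
    have hl0 : (l : Scl (towerM L M k)) = 0 :=
      eq_zero_of_Dg_eq_zero L M k ((mem_resid_iff L M k _).1 l.2) (by rw [hm0, zero_sub, neg_eq_zero] at h'; exact h')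
    ext <;> simp [hm0, hl0]
  · intro n
    have hn := (mem_fdir_iff L M k _).1 n.2
    have htop : (n : Fld (towerM L M k)) ∈ Lan L M k ⊔ orbit L M k := by rw [hc.sup_eq_top]; exact Submodule.mem_top
    obtain ⟨a, ha, g, hg, hsum⟩ := Submodule.mem_sup.1 htop
    obtain ⟨l, hl, rfl⟩ := (mem_orbit_iff L M k g).1 hg
    have haQ : Qk L M k a = 0 := by
      have : Qk L M k (a + Dg L M k l) = 0 := by rw [hsum]; exact hn
      rwa [map_add, Qk_Dg_eq_zero L M k hl, add_zero] at this
    refine ⟨(⟨a, (mem_dirSpace_iff a).2 ⟨haQ, ha⟩⟩, ⟨-l, (mem_resid_iff L M k _).2 (by rw [map_neg, hl, neg_zero])⟩), ?_⟩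
    apply Subtype.ext
    rw [coordMap_coe]
    simp only [map_neg, sub_neg_eq_add]
    exact hsum

/-- the coordinates as a continuous linear equivalence. [cite: Balaban1984PropagatorsI, (1.46) p.26] -/
def coordEquiv (k : ℕ) : (LanDir L M k × resid L M k) ≃L[ℝ] fdir L M k :=
  (LinearEquiv.ofBijective (coordMap L M k) (coordMap_bijective L M k)).toContinuousLinearEquiv

/-- pointwise, in the shape of p22's `he`: `ι(e(m, λ)) = σ m − D λ`. [cite: Balaban1984PropagatorsI, (1.46) p.26] -/
theorem coordEquiv_he (k : ℕ) (m : LanDir L M k) (l : resid L M k) :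
    (fdir L M k).subtype (coordEquiv L M k (m, l)) = (LanDir L M k).subtype m - (Dg L M k ∘ₗ (resid L M k).subtype) l :=
  rfl

/-! ## §2  Dictionary: the adjoint-based `∂*`, `Δ` of `B5Eq147Landau` are p37's formula-based `dvR`, `LapR` -/

/-- **`∂*` = `∂*`**: `B5Eq147Landau.Dv` (adjoint of `∂^{L^k}`) equals `B5Eq123Torus.dvR` (backward differences).
[cite: Balaban1984PropagatorsI, (1.21) p.21] -/
theorem Dv_eq_dvR (k : ℕ) (A : Fld (towerM L M k)) : Dv L M k A = dvR L M k A := by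
  ext x
  rw [Dv_apply, dvR, PiLp.toLp_apply, Finset.mul_sum]

/-- **`Δ` = `Δ`**: `B5Eq147Landau.Lap` (`∂*∂` via adjoints) equals `B5Eq123Torus.LapR` (the real matrix of the tree's `LapS` at
`c = L^k`). [cite: Balaban1984PropagatorsI, (1.21) p.21] -/
theorem Lap_eq_LapR (k : ℕ) (l : Scl (towerM L M k)) : Lap L M k l = LapR L M k l := by
  ext x
  apply Complex.ofReal_injective
  rw [← B5Eq123Torus.LapS_cplxS, B5Action121.LapS_mulVec, Lap_apply, map_pow, map_natCast]
  simp only [cplxS]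
  push_cast
  rw [Finset.mul_sum]
  refine Finset.sum_congr rfl fun μ _ => ?_
  ring

/-- the Landau gauge in p37's letters: `A ∈ Lan k ↔ ⟨∂*A, Δλ⟩ = 0` for all `λ ∈ N(Q′_k)`, with `∂* = dvR`, `Δ = LapR`.
[cite: Balaban1984PropagatorsI, (1.47) p.26] -/
theorem mem_Lan_iff_dvR (k : ℕ) (A : Fld (towerM L M k)) :
    A ∈ Lan L M k ↔ ∀ l : Scl (towerM L M k), Qsk L M k l = 0 → inner ℝ (dvR L M k A) (LapR L M k l) = 0 := by
  rw [mem_Lan_iff_inner]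
  refine forall_congr' fun l => forall_congr' fun _ => ?_
  rw [Dv_eq_dvR, Lap_eq_LapR]

/-! ## §3  (1.23) ⟹ (1.47) -/

/-- every `B` has a Landau-gauge representative on `{Q_kA = B}`. [cite: Balaban1984PropagatorsI, (1.47) p.26] -/
theorem exists_mem_fibre_Lan (k : ℕ) (B : Fld M) : ∃ A : Fld (towerM L M k), A ∈ fibre (Qk L M k) (Lan L M k) B := by
  have htop : secK L M k B ∈ Lan L M k ⊔ orbit L M k := by
    rw [(isCompl_Lan_orbit L M k).sup_eq_top]; exact Submodule.mem_top
  obtain ⟨a, ha, g, hg, hsum⟩ := Submodule.mem_sup.1 htop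
  refine ⟨a, ?_, ha⟩
  have : Qk L M k (a + g) = B := by rw [hsum]; exact qk_secK L M k B
  rwa [map_add, LinearMap.mem_ker.1 (orbit_le_ker L M k hg), add_zero] at this

/-- **(1.23) ⟹ (1.47), exactly**: there is ONE constant `c > 0` such that for every `α` with (1.22)'s denominator non-zero
(`Claim122 k α`) and every `B`,
`∫dA δ(B − Q_kA)δ_R(∂*A)e^{−S^η(A)} = c·∫dA δ(B − Q_kA) e^{−(1/2α)⟨∂*A,∂*A⟩}(∫dλ δ(Q′_kλ)e^{−(1/2α)⟨∂*A^λ,∂*A^λ⟩})⁻¹ e^{−S^η(A)}`,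
i.e. `rt47 k B = c·rt23 k α B` — the orbit integral of the gauge-fixing weight is `1` («from its definition it follows that
∫dλ δ(Q′_kλ)𝒢_α(∂*A^λ) = 1»), so the density `𝒢_α` may be replaced by the unit-mass `δ_R` of (1.46) at no cost but a Jacobian.
[cite: Balaban1984PropagatorsI, (1.41) p.25, (1.46)–(1.47) p.26] -/
theorem rt47_eq_const_mul_rt23 (k : ℕ) : ∃ c : ℝ, 0 < c ∧ ∀ α : ℝ, Claim122 L M k α →
    ∀ B : Fld M, rt47 L M k B = c * rt23 L M k α B := by
  obtain ⟨c, hc, H⟩ := B5ChangeOfGauge123.eq123_zprime (volume : Measure (LanDir L M k))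
    (volume : Measure (resid L M k)) (volume : Measure (fdir L M k)) (coordEquiv L M k) (LanDir L M k).subtype
    (fdir L M k).subtype (Dg L M k ∘ₗ (resid L M k).subtype) (coordEquiv_he L M k)
  refine ⟨c, hc, fun α h122 B => ?_⟩
  obtain ⟨a, ha⟩ := exists_mem_fibre_Lan L M k B
  have haTop : a ∈ fibre (Qk L M k) ⊤ B := ⟨ha.1, Submodule.mem_top⟩
  set g : Fld (towerM L M k) → ℝ := fun A => Real.exp (-(1 / (2 * α)) * divSq L M k A) with hg
  set ρ : Fld (towerM L M k) → ℝ := fun A => Real.exp (-actionEta L M k A) with hρ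
  -- the hypotheses of p22's engine
  have hg0 : ∀ A, 0 ≤ g A := fun A => (Real.exp_pos _).le
  have hρ0 : ∀ A, 0 ≤ ρ A := fun A => (Real.exp_pos _).le
  have hgc : Continuous g := by
    rw [hg]; exact Real.continuous_exp.comp (continuous_const.mul (B5Eq123Torus.continuous_divSq L M k))
  have hρc : Continuous ρ := by
    rw [hρ]; exact Real.continuous_exp.comp (B5Eq123Torus.continuous_actionEta L M k).neg
  have hgm : AEStronglyMeasurable (fun p : LanDir L M k × resid L M k =>
      g (a + (LanDir L M k).subtype p.1 - (Dg L M k ∘ₗ (resid L M k).subtype) p.2))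
      ((volume : Measure (LanDir L M k)).prod volume) := by
    refine (hgc.comp ?_).aestronglyMeasurable
    exact ((continuous_const.add (continuous_subtype_val.comp continuous_fst)).sub
      ((Dg L M k).continuous_of_finiteDimensional.comp (continuous_subtype_val.comp continuous_snd)))
  have hρm : AEStronglyMeasurable (fun m : LanDir L M k => ρ (a + (LanDir L M k).subtype m))
      (volume : Measure (LanDir L M k)) :=
    (hρc.comp (continuous_const.add continuous_subtype_val)).aestronglyMeasurable
  have hρinv : ∀ (m : LanDir L M k) (l : resid L M k),
      ρ (a + (LanDir L M k).subtype m - (Dg L M k ∘ₗ (resid L M k).subtype) l) = ρ (a + (LanDir L M k).subtype m) := by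
    intro m l
    simp only [hρ, LinearMap.comp_apply, Submodule.subtype_apply, ← gaugeR_eq_sub_Dg, actionEta_gaugeR]
  have hZ : ∀ m : LanDir L M k,
      ∫ l : resid L M k, g (a + (LanDir L M k).subtype m - (Dg L M k ∘ₗ (resid L M k).subtype) l) ≠ 0 := by
    intro m
    have h := h122 (a + (LanDir L M k).subtype m)
    rw [fp22_eq_orbit] at h
    exact h
  have key := H a g ρ 1 hg0 hρ0 hgm hρm hρinv hZ
  rw [one_mul, one_mul] at key
  -- left side = rt47, right side = rt23
  rw [rt47, deltaInt_eq _ ha, rt23, deltaInt_eq _ haTop]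
  have hL : (fun v : LanDir L M k => Real.exp (-actionEta L M k (a + (v : Fld (towerM L M k)))))
      = fun m => ρ (a + (LanDir L M k).subtype m) := by funext v; rfl
  have hR : (fun v : fdir L M k =>
      Real.exp (-(1 / (2 * α)) * divSq L M k (a + (v : Fld (towerM L M k)))) *
        (fp22 L M k α (a + (v : Fld (towerM L M k))))⁻¹ * Real.exp (-actionEta L M k (a + (v : Fld (towerM L M k)))))
      = fun n => g (a + (fdir L M k).subtype n) *
        (∫ l : resid L M k, g (a + (fdir L M k).subtype n - (Dg L M k ∘ₗ (resid L M k).subtype) l))⁻¹ *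
          ρ (a + (fdir L M k).subtype n) := by
    funext n
    rw [fp22_eq_orbit]
    rfl
  rw [hL, hR, key]

/-- the same for every `α > 0`, (1.22)'s non-vanishing discharged by p37's `B5Eq123Torus.claim122`.
[cite: Balaban1984PropagatorsI, (1.46)–(1.47) p.26] -/
theorem rt47_eq_const_mul_rt23_of_pos (k : ℕ) : ∃ c : ℝ, 0 < c ∧ ∀ α : ℝ, 0 < α →
    ∀ B : Fld M, rt47 L M k B = c * rt23 L M k α B := by
  obtain ⟨c, hc, H⟩ := rt47_eq_const_mul_rt23 L M k
  exact ⟨c, hc, fun α hα B => H α (B5Eq123Torus.claim122 L M k hα) B⟩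

/-- **`rt23 k α B` does not depend on `α`** (for admissible `α`, `α′`) — the exact content, at the level of the integral
(1.23), of «𝒢_α(∂*A) ⟶_{α→0} ∣det(Δ↾_{N(Q′_k)})∣δ_R(∂*A)» (1.41). [cite: Balaban1984PropagatorsI, (1.41) p.25] -/
theorem rt23_eq_rt23 (k : ℕ) {α α' : ℝ} (hα : 0 < α) (hα' : 0 < α') (B : Fld M) :
    rt23 L M k α B = rt23 L M k α' B := by
  obtain ⟨c, hc, H⟩ := rt47_eq_const_mul_rt23_of_pos L M k
  have h1 := H α hα B
  have h2 := H α' hα' B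
  rw [h1] at h2
  exact mul_left_cancel₀ hc.ne' h2

/-- **(1.23) ⟹ (1.47)**: the typed (1.23) (`B5SectBStatements.Eq123 k`) gives the typed (1.47) (`B5Eq147Landau.Eq147 k`) — «In
the sequel it will be convenient to take the limit α → 0, i.e. to consider Landau gauge». [cite: Balaban1984PropagatorsI, (1.47) p.26] -/
theorem eq147_of_eq123 (k : ℕ) (h123 : Eq123 L M k) : Eq147 L M k := by
  obtain ⟨z', hz', hB⟩ := h123 1 one_pos
  obtain ⟨c, hc, H⟩ := rt47_eq_const_mul_rt23_of_pos L M k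
  refine ⟨z' * c⁻¹, mul_pos hz' (inv_pos.2 hc), fun B => ?_⟩
  rw [hB B, H 1 one_pos B, mul_assoc, ← mul_assoc c⁻¹, inv_mul_cancel₀ hc.ne', one_mul]

/-- **(1.47) for every `k` along the PRINTED route** (1.17) → (1.23) → (1.47) (d ≥ 2; p37's `eq123_holds`); the same statement
as `B5Eq147Landau.eq147_holds` (which goes (1.17) → (1.47) directly by (1.46)). [cite: Balaban1984PropagatorsI, (1.47) p.26] -/
theorem eq147_holds' (hd : 2 ≤ d) (k : ℕ) : Eq147 L M k :=
  eq147_of_eq123 L M k (B5Eq123Torus.eq123_holds L M hd k)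

end

end Literature.MathematicalPhysics.QuantumFieldTheory.Balaban1983to89.B5Eq147FromEq123
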